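import Literature.NumberTheory.EllipticCurves.FunctionFieldEllipticLFormalProofs
import Literature.NumberTheory.EllipticCurves.FunctionFieldEllipticLOrderProofs
import HarnessLib

/-!
# The analytic rank of `E/F` from a *formal* identity for `L(E, T) ∈ ℤ[[T]]`

Trunk T-ELLARITH, group G16 `EllArithM`; proof brick of the provefact unit on the bsd.S33 fact
`Literature.NumberTheory.EllipticCurves.analyticRank_eq_iff_finite_sha` (theorems only, no new
named fact, D-0026), companion of
`Literature.NumberTheory.EllipticCurves.FunctionFieldEllipticLOrderProofs` (the analytic rank from an
*analytic* identity `L(E, s) = ∏ᵢ (1 - αᵢ q^{-s})` on `re s > 3/2`) and of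
`Literature.NumberTheory.EllipticCurves.FunctionFieldEllipticLFormalProofs` (the formal series
`L(E, T) = formalL Fq W` of Ulmer's display (9.1) and its comparison with the Euler product).

## Source and purpose

D. Ulmer, *Elliptic curves over function fields*, IAS/Park City Math. Ser. 18 (2011)
(arXiv:1101.1939), Lecture 1, §9: `L(E, T)` is defined by the Euler product (9.1) in the formal
indeterminate `T` and `L(E, s) = L(E, q^{-s})`; Theorem 9.3 / Exercise 9.2: it is a rational function
of `T` (a polynomial for non-constant `E`), "in all cases holomorphic at `s = 1`"; Lecture 4, §1.3,
Theorem ("Grothendieck's analysis"): the cohomological expression of `L(E, T)` is obtained "multiplying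
by `Tⁿ/n`, summing over `n ≥ 1`, and exponentiating" — *an identity of formal power series in `T`*.
Tate, Sém. Bourbaki 306 (1966), §4, (iv): "`ρ(X)` is the multiplicity of `q` as reciprocal root of
`P₂(X, T)`", i.e. orders at `s = 1` are read off as root multiplicities at `T = q⁻¹`.

Accordingly, whatever theory eventually supplies Grothendieck's formula will deliver a **formal**
identity `Q · L(E, T) = P` in `ℤ[[T]]` (`P, Q ∈ ℤ[T]`), not an analytic one. This file turns such an
identity into the value of the analytic rank of the prelude,
`FunctionField.analyticRank W = ord_{s=1} L(E, s)`:

* `analyticOrderAt_eval_polynomial`, `analyticOrderNatAt_eval_polynomial` — the order of vanishing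
  of a complex polynomial at a point is its root multiplicity there;
* `analyticOrderNatAt_aeval_natCast_cpow_neg`, `analyticOrderNatAt_aeval_div_aeval` — through the
  chart `T = q^{-s}` (`q ≥ 2`, so `dT/ds = -log q · q^{-s} ≠ 0`): `ord_{s=1} P(q^{-s}) = mult_{q⁻¹} P`,
  and the same for `P(q^{-s})/Q(q^{-s})` when `Q(q⁻¹) ≠ 0`;
* `analyticRank_eq_rootMultiplicity_of_ellLFunction_eq_div` — if the Euler product equals
  `P(q^{-s})/Q(q^{-s})` on `re s > 3/2` with `Q(q⁻¹) ≠ 0`, then `r_an = mult_{q⁻¹} P` (any field `F`);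
* `analyticRank_eq_rootMultiplicity_of_mul_formalL_eq` — over a global function field, from the
  formal identity `Q · formalL Fq W = P` with `Q(0) = 1` and the roots of `Q` on
  `|z| ∈ {q^{-1/2}, q^{-3/2}}` (exactly the clauses of the named fact `isRational_formalL`):
  `r_an = mult_{q⁻¹} P`; the polynomial case `formalL Fq W = P`
  (`analyticRank_eq_rootMultiplicity_of_formalL_eq`); the same multiplicity computed in `ℚ[T]`
  (`rootMultiplicity_map_complex_eq_map_rat`, `analyticRank_eq_rootMultiplicity_rat_of_formalL_eq`);
* `rootMultiplicity_inv_prod_one_sub_C_mul_X` — `mult_{c⁻¹} ∏ᵢ (1 - αᵢ T) = #{i : αᵢ = c}`, which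
  recovers the Weil-form statement of `FunctionFieldEllipticLOrderProofs` from the formal one
  (`analyticRank_eq_card_of_formalL_eq_prod`);
* `rootMultiplicity_inv_reverse` — `mult_{c⁻¹}(p.reverse) = mult_c(p)` for `c ≠ 0`: roots of
  `L(E, T)` at `q⁻¹` are reciprocal roots `q`, the form in which a characteristic polynomial of
  Frobenius enters (`Matrix.reverse_charpoly`); `analyticRank_eq_rootMultiplicity_reverse_of_formalL_eq`.

For the bsd.S33 residual (`analyticRank_eq_iff_finite_sha_of_tatePackages`, hypothesis `hP`:
`P.rootMultiplicity 1 = analyticRank W + c₀` for the rational characteristic polynomial of Frobenius)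
this is the analytic-to-formal adapter: once `L(E, T)` is identified with a reversed characteristic
polynomial *formally*, `hP` is pure algebra. Relies on: no named fact.

## References

* [Ulmer2011ParkCity] D. Ulmer, *Elliptic curves over function fields*, IAS/Park City Math. Ser. 18
  (2011), Lecture 1, §9 ((9.1), Exercise 9.2, Thm. 9.3); Lecture 4, §1.3. arXiv:1101.1939.
* [Tate1966Bourbaki] J. Tate, *On the conjectures of Birch and Swinnerton-Dyer and a geometric
  analog*, Sém. Bourbaki 306 (1966), §4.
-/

noncomputable section

open scoped Classical Polynomial

namespace Literature.NumberTheory.EllipticCurves.FunctionField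

open Complex Filter Topology Polynomial

/-! ## The order of a polynomial at a point -/

section PolynomialOrder

/-- For a non-zero complex polynomial `P` and `a ∈ ℂ`, the order of vanishing of `z ↦ P(z)` at `a`
is the root multiplicity `mult_a(P)`: write `P = (X - a)^m R` with `R(a) ≠ 0`. [folklore] -/
theorem analyticOrderAt_eval_polynomial {P : ℂ[X]} (hP : P ≠ 0) (a : ℂ) :
    analyticOrderAt (fun z => P.eval z) a = P.rootMultiplicity a := by
  set m := P.rootMultiplicity a with hm
  set R := P /ₘ (X - C a) ^ m with hR
  have hdec : (X - C a) ^ m * R = P := P.pow_mul_divByMonic_rootMultiplicity_eq a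
  have hRa : R.eval a ≠ 0 := eval_divByMonic_pow_rootMultiplicity_ne_zero a hP
  have hfun : (fun z => P.eval z) = ((· - a) ^ m) * fun z => R.eval z := by
    funext z
    conv_lhs => rw [← hdec]
    simp [eval_pow]
  have h1 : AnalyticAt ℂ ((· - a) ^ m) a := by fun_prop
  have h2 : AnalyticAt ℂ (fun z => R.eval z) a := (R.differentiable.analyticAt a)
  rw [hfun, analyticOrderAt_mul h1 h2, analyticOrderAt_centeredMonomial,
    h2.analyticOrderAt_eq_zero.mpr hRa, add_zero]

/-- For every complex polynomial `P` (including `P = 0`, where both sides are `0`) and `a ∈ ℂ`,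
`ord_{z=a} P(z) = mult_a(P)` as natural numbers (`analyticOrderNatAt`). [folklore] -/
theorem analyticOrderNatAt_eval_polynomial (P : ℂ[X]) (a : ℂ) :
    analyticOrderNatAt (fun z => P.eval z) a = P.rootMultiplicity a := by
  by_cases hP : P = 0
  · subst hP
    have h : analyticOrderAt (fun _ : ℂ => (0 : ℂ)) a = ⊤ :=
      analyticOrderAt_eq_top.mpr (Filter.Eventually.of_forall fun _ => rfl)
    simp only [eval_zero, rootMultiplicity_zero, analyticOrderNatAt, h, ENat.toNat_top]
  · rw [analyticOrderNatAt, analyticOrderAt_eval_polynomial hP, ENat.toNat_coe]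

/-- **Through the chart `T = q^{-s}`.** For `q ≥ 2` and `P ∈ ℤ[T]`,
`ord_{s=1} P(q^{-s}) = mult_{q⁻¹} P` (root multiplicity of `P` in `ℂ[T]` at `T = q⁻¹`): the map
`s ↦ q^{-s}` is analytic with derivative `-log q · q^{-1} ≠ 0` at `s = 1`
(`analyticOrderAt_comp_of_deriv_ne_zero`). This is the dictionary "order at `s = 1`" =
"multiplicity of the reciprocal root `q`" of Tate (1966), §4 and Ulmer (2011), Lecture 1, Thm. 9.3.
[folklore] -/
theorem analyticOrderNatAt_aeval_natCast_cpow_neg {q : ℕ} (hq : 1 < q) (P : ℤ[X]) :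
    analyticOrderNatAt (fun s : ℂ => aeval ((q : ℂ) ^ (-s)) P) 1 =
      (P.map (Int.castRingHom ℂ)).rootMultiplicity ((q : ℂ)⁻¹) := by
  have hq0 : q ≠ 0 := by omega
  have hg : AnalyticAt ℂ (fun s : ℂ => (q : ℂ) ^ (-s)) 1 := analyticAt_natCast_cpow_neg hq0 1
  have hg1 : (q : ℂ) ^ (-(1 : ℂ)) = (q : ℂ)⁻¹ := cpow_neg_one _
  have hg' : deriv (fun s : ℂ => (q : ℂ) ^ (-s)) 1 ≠ 0 := by
    rw [(hasDerivAt_natCast_cpow_neg hq0 1).deriv, neg_ne_zero, cpow_neg_one]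
    exact mul_ne_zero (log_natCast_ne_zero hq) (inv_ne_zero (Nat.cast_ne_zero.mpr hq0))
  have hcomp : (fun s : ℂ => aeval ((q : ℂ) ^ (-s)) P) =
      (fun z => (P.map (Int.castRingHom ℂ)).eval z) ∘ fun s : ℂ => (q : ℂ) ^ (-s) := by
    funext s
    simp only [Function.comp_apply, eval_map, aeval_def, algebraMap_int_eq]
  rw [analyticOrderNatAt, hcomp, analyticOrderAt_comp_of_deriv_ne_zero hg hg', hg1]
  exact analyticOrderNatAt_eval_polynomial _ _

/-- For `q ≥ 2` and `P, Q ∈ ℤ[T]` with `Q(q⁻¹) ≠ 0`: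
`ord_{s=1} P(q^{-s})/Q(q^{-s}) = mult_{q⁻¹} P` (the denominator is analytic and non-vanishing at
`s = 1`, so it does not change the order). [folklore] -/
theorem analyticOrderNatAt_aeval_div_aeval {q : ℕ} (hq : 1 < q) (P Q : ℤ[X])
    (hQ : aeval ((q : ℂ) ^ (-(1 : ℂ))) Q ≠ 0) :
    analyticOrderNatAt (fun s : ℂ => aeval ((q : ℂ) ^ (-s)) P / aeval ((q : ℂ) ^ (-s)) Q) 1 =
      (P.map (Int.castRingHom ℂ)).rootMultiplicity ((q : ℂ)⁻¹) := by
  have hq0 : q ≠ 0 := by omega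
  have h := analyticOrderNatAt_aeval_natCast_cpow_neg hq P
  unfold analyticOrderNatAt at h ⊢
  rw [analyticOrderAt_fun_div_of_ne_zero (analyticAt_aeval_natCast_cpow_neg hq0 P 1)
      (analyticAt_aeval_natCast_cpow_neg hq0 Q 1) hQ]
  exact h

/-- Root multiplicities of an integer polynomial at `q⁻¹` agree in `ℂ[T]` and in `ℚ[T]`
(`Polynomial.eq_rootMultiplicity_map` along the injection `ℚ → ℂ`). [folklore] -/
theorem rootMultiplicity_map_complex_eq_map_rat (P : ℤ[X]) (q : ℕ) :
    (P.map (Int.castRingHom ℂ)).rootMultiplicity ((q : ℂ)⁻¹) =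
      (P.map (Int.castRingHom ℚ)).rootMultiplicity ((q : ℚ)⁻¹) := by
  have hf : Int.castRingHom ℂ = (algebraMap ℚ ℂ).comp (Int.castRingHom ℚ) := RingHom.ext_int _ _
  have hq : ((q : ℂ))⁻¹ = algebraMap ℚ ℂ ((q : ℚ)⁻¹) := by simp
  rw [hf, ← Polynomial.map_map, hq, ← eq_rootMultiplicity_map (algebraMap ℚ ℂ).injective]

/-- **`mult_{c⁻¹} ∏ᵢ (1 - αᵢ T) = #{i : αᵢ = c}`** over a field, for `c ≠ 0`: the factor `1 - αᵢ T`
vanishes at `c⁻¹` iff `αᵢ = c`, simply. This passes between "roots of `L(E, T)` at `T = q⁻¹`" and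
"inverse roots `αᵢ = q`" (Ulmer (2011), Lecture 1, Thm. 9.3: `L(E, s) = ∏ᵢ (1 - αᵢ q^{-s})`).
[folklore] -/
theorem rootMultiplicity_inv_prod_one_sub_C_mul_X {K : Type*} [Field K] {ι : Type*} (t : Finset ι)
    (α : ι → K) {c : K} (hc : c ≠ 0) :
    (∏ i ∈ t, (1 - C (α i) * X)).rootMultiplicity c⁻¹ = (t.filter fun i => α i = c).card := by
  classical
  -- one factor
  have hne : ∀ i, (1 - C (α i) * X : K[X]) ≠ 0 := fun i h => by
    have := congrArg (fun p : K[X] => p.coeff 0) h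
    simp at this
  have hone : ∀ i, ((1 - C (α i) * X : K[X])).rootMultiplicity c⁻¹ = if α i = c then 1 else 0 := by
    intro i
    by_cases hα : α i = 0
    · have hαc : ¬ α i = c := fun h => hc (by rw [← h, hα])
      rw [if_neg hαc, hα, C_0, zero_mul, sub_zero, ← C_1, rootMultiplicity_C]
    · have h1 : C (α i) * C (α i)⁻¹ = (1 : K[X]) := by rw [← C_mul, mul_inv_cancel₀ hα, C_1]
      have hfac : (1 - C (α i) * X : K[X]) = C (-α i) * (X - C (α i)⁻¹) := by
        rw [C_neg]
        linear_combination -h1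
      have hprod : C (-α i) * (X - C (α i)⁻¹) ≠ 0 := hfac ▸ hne i
      rw [hfac, rootMultiplicity_mul hprod, rootMultiplicity_C, zero_add, rootMultiplicity_X_sub_C]
      by_cases h : α i = c
      · rw [if_pos h, if_pos (by rw [h])]
      · rw [if_neg h, if_neg (fun h' => h (inv_injective h').symm)]
  -- the product
  rw [Finset.card_filter]
  induction t using Finset.cons_induction with
  | empty => rw [Finset.prod_empty, Finset.sum_empty, ← C_1, rootMultiplicity_C]
  | cons a s ha ih =>
    rw [Finset.prod_cons, Finset.sum_cons,
      rootMultiplicity_mul (mul_ne_zero (hne a) (Finset.prod_ne_zero_iff.mpr fun i _ => hne i)),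
      hone a, ih]

/-- **Roots versus reciprocal roots.** Over a field, for `c ≠ 0` the multiplicity of `c⁻¹` as a
root of the reciprocal polynomial `p.reverse` is the multiplicity of `c` as a root of `p`
("`ρ` is the multiplicity of `q` as *reciprocal* root of `P₂(X, T)`", Tate (1966), §4, (iv);
applied below with `p` the reciprocal of `L(E, T)`). [folklore] -/
theorem rootMultiplicity_inv_reverse {K : Type*} [Field K] (p : K[X]) {c : K} (hc : c ≠ 0) :
    p.reverse.rootMultiplicity c⁻¹ = p.rootMultiplicity c := by
  classical
  by_cases hp : p = 0
  · simp [hp]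
  set m := p.rootMultiplicity c with hm
  set r := p /ₘ (X - C c) ^ m with hr
  have hdec : (X - C c) ^ m * r = p := p.pow_mul_divByMonic_rootMultiplicity_eq c
  have hrc : r.eval c ≠ 0 := eval_divByMonic_pow_rootMultiplicity_ne_zero c hp
  have hr0 : r ≠ 0 := fun h => hrc (by rw [h, eval_zero])
  -- `reverse p = (-c)^m · (X - c⁻¹)^m · reverse r`
  have h1 : (1 - C c * X : K[X]) = C (-c) * (X - C c⁻¹) := by
    have : C c * C c⁻¹ = (1 : K[X]) := by rw [← C_mul, mul_inv_cancel₀ hc, C_1]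
    rw [C_neg]
    linear_combination -this
  -- `reverse` commutes with powers over a domain (same statement as
  -- `Literature.NumberTheory.GaloisRepresentations.reverse_pow_of_domain`; inlined to keep imports light)
  have hrevpow : ∀ n : ℕ, ((X - C c : K[X]) ^ n).reverse = (X - C c : K[X]).reverse ^ n := by
    intro n
    induction n with
    | zero => rw [pow_zero, pow_zero, ← C_1, reverse_C]
    | succ n ih => rw [pow_succ, reverse_mul_of_domain, ih, pow_succ]
  -- the reciprocal polynomial of `X - c` is `1 - cX` (as in several sibling files, e.g.
  -- `HasseWeilAbelianBadReduction`; inlined to keep imports light)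
  have hrevX : (X - C c : K[X]).reverse = 1 - C c * X := by
    have hX : (X : K[X]).reverse = 1 := by rw [← one_mul X, reverse_mul_X, ← C_1, reverse_C]
    rw [sub_eq_add_neg, ← C_neg, reverse_add_C, hX, natDegree_X, pow_one, C_neg, neg_mul,
      ← sub_eq_add_neg]
  have hrev : p.reverse = C ((-c) ^ m) * (X - C c⁻¹) ^ m * r.reverse := by
    rw [← hdec, reverse_mul_of_domain, hrevpow, hrevX, h1, mul_pow, C_pow]
  -- `(reverse r)(c⁻¹) ≠ 0`
  have hrev_r : ¬ (r.reverse).IsRoot c⁻¹ := by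
    haveI : Invertible c := invertibleOfNonzero hc
    have h : r.reverse.eval c⁻¹ * c ^ r.natDegree = r.eval c := by
      have := eval₂_reverse_mul_pow (RingHom.id K) c r
      rwa [invOf_eq_inv] at this
    intro h0
    rw [IsRoot.def] at h0
    rw [h0, zero_mul] at h
    exact hrc h.symm
  have hA : C ((-c) ^ m) * (X - C c⁻¹) ^ m ≠ 0 :=
    mul_ne_zero (C_ne_zero.mpr (pow_ne_zero _ (neg_ne_zero.mpr hc))) (pow_ne_zero _ (X_sub_C_ne_zero _))
  have hB : r.reverse ≠ 0 := fun h => hr0 (reverse_eq_zero.mp h)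
  rw [hrev, rootMultiplicity_mul (mul_ne_zero hA hB), rootMultiplicity_mul hA, rootMultiplicity_C,
    zero_add, rootMultiplicity_X_sub_C_pow, rootMultiplicity_eq_zero hrev_r, add_zero]

end PolynomialOrder

/-! ## The analytic rank from a rational expression of the Euler product -/

section AnyField

variable {F : Type} [Field F] (W : WeierstrassCurve F)

/-- **`r_an = mult_{q⁻¹} P` from `L(E, s) = P(q^{-s})/Q(q^{-s})`.** Let `q ≥ 2` and `P, Q ∈ ℤ[T]`
with `Q(q⁻¹) ≠ 0`. If the Euler product `ellLFunction W` equals `P(q^{-s})/Q(q^{-s})` on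
`re s > 3/2`, then that rational function of `q^{-s}` is an admissible continuation
(`mem_lContinuations_of_eq_rational`), the analytic rank is its order at `s = 1`
(`analyticRank_eq_analyticOrderNatAt_of_mem_lContinuations`, choice-free), hence
`analyticRank W = mult_{q⁻¹} P` (`analyticOrderNatAt_aeval_div_aeval`). Ulmer (2011), Lecture 1,
§9 with Thm. 9.3 / Exercise 9.2 ("`L(E,s)` is a rational function in `q^{-s}`", "holomorphic at
`s = 1`"). Relies on: the explicit identity `hL` (no named fact).
[cite: Ulmer2011ParkCity, Lect. 1, §9, Thm. 9.3 and Exercise 9.2] -/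
theorem analyticRank_eq_rootMultiplicity_of_ellLFunction_eq_div {q : ℕ} (hq : 1 < q) (P Q : ℤ[X])
    (hQ : aeval ((q : ℂ) ^ (-(1 : ℂ))) Q ≠ 0)
    (hL : ∀ s : ℂ, (3 / 2 : ℝ) < s.re →
      ellLFunction W s = aeval ((q : ℂ) ^ (-s)) P / aeval ((q : ℂ) ^ (-s)) Q) :
    analyticRank W = (P.map (Int.castRingHom ℂ)).rootMultiplicity ((q : ℂ)⁻¹) := by
  rw [analyticRank_eq_analyticOrderNatAt_of_mem_lContinuations W
      (mem_lContinuations_of_eq_rational W (by omega) P Q hQ hL)]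
  exact analyticOrderNatAt_aeval_div_aeval hq P Q hQ

/-- The polynomial case: if `ellLFunction W s = P(q^{-s})` on `re s > 3/2` (`q ≥ 2`, `P ∈ ℤ[T]`),
then `analyticRank W = mult_{q⁻¹} P` — Ulmer's "`L(E,s)` is a polynomial in `q^{-s}`" case
(non-constant `E`, Thm. 9.3). Relies on: the explicit identity `hL` (no named fact).
[cite: Ulmer2011ParkCity, Lect. 1, §9, Thm. 9.3] -/
theorem analyticRank_eq_rootMultiplicity_of_ellLFunction_eq_aeval {q : ℕ} (hq : 1 < q) (P : ℤ[X])
    (hL : ∀ s : ℂ, (3 / 2 : ℝ) < s.re → ellLFunction W s = aeval ((q : ℂ) ^ (-s)) P) :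
    analyticRank W = (P.map (Int.castRingHom ℂ)).rootMultiplicity ((q : ℂ)⁻¹) :=
  analyticRank_eq_rootMultiplicity_of_ellLFunction_eq_div W hq P 1 (by simp) fun s hs => by
    rw [hL s hs, map_one, div_one]

end AnyField

/-! ## The analytic rank from a formal identity `Q · L(E, T) = P` in `ℤ[[T]]` -/

section FunctionField

variable (Fq : Type) [Field Fq] [Fintype Fq] {F : Type} [Field F] [Algebra Fq[X] F]
  [Algebra (RatFunc Fq) F] [IsScalarTower Fq[X] (RatFunc Fq) F] [FunctionField Fq F]
  (W : WeierstrassCurve F)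

/-- **The analytic rank from a formal identity.** Over a global function field `F ⊇ 𝔽_q(t)`
(`q = #Fq`), suppose `Q · L(E, T) = P` in `ℤ[[T]]` for Ulmer's formal series
`L(E, T) = formalL Fq W` of display (9.1), with `P, Q ∈ ℤ[T]`, `Q(0) = 1` and every complex root of
`Q` on `|z| = q^{-1/2}` or `|z| = q^{-3/2}` — precisely the clauses of the named fact
`isRational_formalL` (Exercise 9.2 / Thm. 9.3 read formally), and the shape in which a trace
formula delivers `L(E, T)` (Lecture 4, §1.3: "an identity of formal power series"). Then
`ord_{s=1} L(E, s) = analyticRank W = mult_{q⁻¹} P`.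
Proof: the formal identity gives `ellLFunction W s = P(q^{-s})/Q(q^{-s})` on `re s > 3/2`
(`ellLFunction_eq_div_of_mul_formalLInv_eq`, sibling `FunctionFieldEllipticLFormalProofs`) and
`Q(q⁻¹) ≠ 0` (`aeval_card_cpow_neg_one_ne_zero`); conclude by
`analyticRank_eq_rootMultiplicity_of_ellLFunction_eq_div`. Relies on: the explicit identity `hPQ`
(no named fact). [cite: Ulmer2011ParkCity, Lect. 1, §9, (9.1), Exercise 9.2 and Thm. 9.3; Lect. 4, §1.3] -/
theorem analyticRank_eq_rootMultiplicity_of_mul_formalL_eq {P Q : ℤ[X]}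
    (hPQ : (Q : PowerSeries ℤ) * formalL Fq W = P) (hQ0 : Q.coeff 0 = 1)
    (hroots : ∀ z ∈ (Q.map (Int.castRingHom ℂ)).roots,
      ‖z‖ = (Fintype.card Fq : ℝ) ^ (-(1 / 2 : ℝ)) ∨ ‖z‖ = (Fintype.card Fq : ℝ) ^ (-(3 / 2 : ℝ))) :
    analyticRank W = (P.map (Int.castRingHom ℂ)).rootMultiplicity ((Fintype.card Fq : ℂ)⁻¹) :=
  analyticRank_eq_rootMultiplicity_of_ellLFunction_eq_div W Fintype.one_lt_card P Q
    (aeval_card_cpow_neg_one_ne_zero Fq hQ0 hroots) fun _ hs =>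
    ellLFunction_eq_div_of_mul_formalLInv_eq Fq W (mul_formalLInv_eq_of_mul_formalL_eq Fq W hPQ)
      hQ0 hroots hs

/-- **The polynomial case.** If `L(E, T) = formalL Fq W` *is* a polynomial `P ∈ ℤ[T]` (Ulmer (2011),
Lecture 1, Thm. 9.3 for non-constant `E`: "`L(E,s)` is a polynomial in `q^{-s}`"), then
`analyticRank W = mult_{q⁻¹} P`. Relies on: the explicit identity `hP` (no named fact).
[cite: Ulmer2011ParkCity, Lect. 1, §9, Thm. 9.3] -/
theorem analyticRank_eq_rootMultiplicity_of_formalL_eq {P : ℤ[X]} (hP : formalL Fq W = P) :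
    analyticRank W = (P.map (Int.castRingHom ℂ)).rootMultiplicity ((Fintype.card Fq : ℂ)⁻¹) :=
  analyticRank_eq_rootMultiplicity_of_mul_formalL_eq Fq W (Q := 1)
    (by rw [Polynomial.coe_one, one_mul, hP]) (by simp) (by simp)

/-- The same multiplicity computed in `ℚ[T]`: under the formal identity `Q · L(E, T) = P` with the
clauses of `isRational_formalL`, `analyticRank W = mult_{q⁻¹} P` in `ℚ[T]`
(`rootMultiplicity_map_complex_eq_map_rat`); this is the form that meets a rational characteristic
polynomial of Frobenius (Tate (1966), §4, (iv)). Relies on: the explicit identity `hPQ` (no named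
fact). [cite: Tate1966Bourbaki, §4] -/
theorem analyticRank_eq_rootMultiplicity_rat_of_mul_formalL_eq {P Q : ℤ[X]}
    (hPQ : (Q : PowerSeries ℤ) * formalL Fq W = P) (hQ0 : Q.coeff 0 = 1)
    (hroots : ∀ z ∈ (Q.map (Int.castRingHom ℂ)).roots,
      ‖z‖ = (Fintype.card Fq : ℝ) ^ (-(1 / 2 : ℝ)) ∨ ‖z‖ = (Fintype.card Fq : ℝ) ^ (-(3 / 2 : ℝ))) :
    analyticRank W = (P.map (Int.castRingHom ℚ)).rootMultiplicity ((Fintype.card Fq : ℚ)⁻¹) := by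
  rw [analyticRank_eq_rootMultiplicity_of_mul_formalL_eq Fq W hPQ hQ0 hroots,
    rootMultiplicity_map_complex_eq_map_rat]

/-- The polynomial case in `ℚ[T]`: `formalL Fq W = P ⟹ analyticRank W = mult_{q⁻¹} P` in `ℚ[T]`.
Relies on: the explicit identity `hP` (no named fact). [cite: Ulmer2011ParkCity, Lect. 1, §9, Thm. 9.3] -/
theorem analyticRank_eq_rootMultiplicity_rat_of_formalL_eq {P : ℤ[X]} (hP : formalL Fq W = P) :
    analyticRank W = (P.map (Int.castRingHom ℚ)).rootMultiplicity ((Fintype.card Fq : ℚ)⁻¹) := by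
  rw [analyticRank_eq_rootMultiplicity_of_formalL_eq Fq W hP, rootMultiplicity_map_complex_eq_map_rat]

/-- **Reciprocal roots.** In the polynomial case `formalL Fq W = P`, the analytic rank is the
multiplicity of `q` itself as a root of the *reciprocal* polynomial of `L(E, T)` in `ℚ[T]`
(`T^N L(E, 1/T) = ∏ᵢ (T - αᵢ)` in the notation of Ulmer (2011), Lecture 1, Thm. 9.3), i.e. "the
multiplicity of `q` as reciprocal root" in the sense of Tate (1966), §4, (iv) — the form that meets a
characteristic polynomial of Frobenius through Mathlib's `Matrix.reverse_charpoly`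
(`charpoly.reverse = charpolyRev = det(1 - T·M)`). Relies on: the explicit identity `hP` (no named
fact). [cite: Tate1966Bourbaki, §4] -/
theorem analyticRank_eq_rootMultiplicity_reverse_of_formalL_eq {P : ℤ[X]} (hP : formalL Fq W = P) :
    analyticRank W = (P.map (Int.castRingHom ℚ)).reverse.rootMultiplicity (Fintype.card Fq : ℚ) := by
  have hq : (Fintype.card Fq : ℚ) ≠ 0 := Nat.cast_ne_zero.mpr Fintype.card_ne_zero
  have h := rootMultiplicity_inv_reverse (P.map (Int.castRingHom ℚ)) (inv_ne_zero hq)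
  rw [inv_inv] at h
  rw [analyticRank_eq_rootMultiplicity_rat_of_formalL_eq Fq W hP]
  exact h.symm

/-- **Weil form, formally.** If `L(E, T) = formalL Fq W` is a polynomial `P ∈ ℤ[T]` which factors
over `ℂ` as `∏_{i ∈ t} (1 - αᵢ T)` (Ulmer (2011), Lecture 1, Thm. 9.3:
`L(E, s) = ∏_{i=1}^{N} (1 - αᵢ q^{-s})`), then `analyticRank W = #{i : αᵢ = q}` — the statement of
`analyticRank_eq_card_of_ellLFunction_eq_prod` (sibling `FunctionFieldEllipticLOrderProofs`) reached
from the *formal* identity instead of the analytic one. Relies on: the explicit identities `hP`,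
`hα` (no named fact). [cite: Ulmer2011ParkCity, Lect. 1, §9, Thm. 9.3] -/
theorem analyticRank_eq_card_of_formalL_eq_prod {P : ℤ[X]} (hP : formalL Fq W = P) {ι : Type*}
    (t : Finset ι) (α : ι → ℂ) (hα : P.map (Int.castRingHom ℂ) = ∏ i ∈ t, (1 - C (α i) * X)) :
    analyticRank W = (t.filter fun i => α i = Fintype.card Fq).card := by
  rw [analyticRank_eq_rootMultiplicity_of_formalL_eq Fq W hP, hα]
  exact rootMultiplicity_inv_prod_one_sub_C_mul_X t α (Nat.cast_ne_zero.mpr Fintype.card_ne_zero)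

/-- Under the named fact `isRational_formalL Fq W` (Grothendieck rationality of `L(E, T)` with the
printed location of the poles), for elliptic `W` the analytic rank is the root multiplicity at
`T = q⁻¹` of the numerator of *some* (any) formal witness: `∃ P Q` with the three clauses and
`analyticRank W = mult_{q⁻¹} P`. Relies on: hypothesis `h` (named fact, not discharged here).
[cite: Ulmer2011ParkCity, Lect. 1, §9, Exercise 9.2 and Thm. 9.3] -/
theorem exists_analyticRank_eq_rootMultiplicity_of_isRational_formalL (h : isRational_formalL Fq W)
    [W.IsElliptic] :
    ∃ P Q : ℤ[X], Q.coeff 0 = 1 ∧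
      (∀ z ∈ (Q.map (Int.castRingHom ℂ)).roots,
        ‖z‖ = (Fintype.card Fq : ℝ) ^ (-(1 / 2 : ℝ)) ∨
          ‖z‖ = (Fintype.card Fq : ℝ) ^ (-(3 / 2 : ℝ))) ∧
      (Q : PowerSeries ℤ) * formalL Fq W = P ∧
      analyticRank W = (P.map (Int.castRingHom ℂ)).rootMultiplicity ((Fintype.card Fq : ℂ)⁻¹) := by
  obtain ⟨P, Q, hQ0, hroots, hPQ⟩ := h
  exact ⟨P, Q, hQ0, hroots, hPQ,
    analyticRank_eq_rootMultiplicity_of_mul_formalL_eq Fq W hPQ hQ0 hroots⟩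

end FunctionField

end Literature.NumberTheory.EllipticCurves.FunctionField
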